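import Summits.CriticalPhenomena.PercolationContinuityZ3.Theorems.PercNearOneGluingNoHeavyLowerTailSahiE3LroOrStep
import Mathlib.Tactic.Linarith
import Mathlib.Tactic.Ring
import Mathlib.Tactic.Positivity
import HarnessLib
import HarnessLib.Audit

/-!
# `NoHeavyLowerTail` (crux stmt-CriticalPhenomena-4575), Sahi programme P4: the two-layer Bernstein reduction of the pair inequality

Support file (cell `prim-l12`, seat P4, generation 19; `--supports stmt-CriticalPhenomena-4575`).  No named facts, no sorries;
standard axioms; def-free.

Setting.  `M` a finite type with a weight `μ` of total mass `1`, a new root variable `y` with `P(y = true) = p`, `P(y = false) = 1 − p`,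
the layered weight `ν(true, m) = p·μ m`, `ν(false, m) = (1−p)·μ m` on `Bool × M`, and a TWO-LAYER SLOT `U = {true} × U₁ ∪ {false} × U₀`
(masses `u₁ = μ(U₁)`, `u₀ = μ(U₀)`).  A candidate certificate that is QUADRATIC in the root law,
  `R(true, m) = p²·Rn m + p(1−p)·R0 m`,   `R(false, m) = p(1−p)·Φ m + (1−p)²·RA m`,
is what the AND-gluing composite `flat₁(V, y ∧ G'')` of the independent OR-step looks like over its root variable `y`
(`U₁ = V ∨ G''`, `U₀ = V × Q''`, `Rn = flat₁(V,G'')`, `R0 = rank-one(R_V; R'' − vν''; 1+v̄)`, `Φ = (ḡ''R_V + g''w) ⊗ ν''`, `RA = R_V ⊗ ν''`;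
HOME prim-l12-p4 gen-18 memo §3b'''' and gen-19 memo FROM-prim-l12-p4-gen19-POLARIZATION.md §1).

THEOREM `slack_two_layer` (pure algebra): for ANY sets `S, S'` of `Bool × M` with layers `S₁, S₀, S₁', S₀'`, the slack of the sandwich
pair inequality (L) of `…SahiE3CertSandwich` is, with `q = 1 − p`, `Δ = μ(S₁) − μ(S₀)`, `Δ' = μ(S₁') − μ(S₀')`,
  `Σ_{S∩S'} R − need(S,S') = p²·[Rn(S₁∩S₁') − need₁(S₁,S₁')] + q²·[RA(S₀∩S₀') − need₀(S₀,S₀')] + pq·[Z + q(u₁−u₀)ΔΔ']`,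
  `Z = R0(S₁∩S₁') + Φ(S₀∩S₀') + u₀(s₁s₀' + s₀s₁') + (u₁−u₀)(s₀s₀' − ΔΔ') − s₁·μ_{U₀}(S₀') − s₁'·μ_{U₀}(S₀) − s₀·μ_{U₁}(S₁') − s₀'·μ_{U₁}(S₁)`
(`need₁`, `need₀` the pair-inequality left-hand sides of the one-layer slots `U₁`, `U₀` on `M`; the p_y-Bernstein expansion of gen 18,
re-derived as a formal polynomial identity).  COROLLARY `pair_two_layer`: if `0 ≤ p ≤ 1`, the top data satisfy (L) for `U₁` at
`(S₁,S₁')`, the bottom data satisfy (L) for `U₀` at `(S₀,S₀')`, and `Z + q(u₁−u₀)ΔΔ' ≥ 0`, then `R` satisfies (L) for `U` at `(S,S')`.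
So the AND-gluing lemma (hence the flagship `(x₀∧(x₁∨x₂)) ∨ (y₀∧(y₁∨y₂))`) is reduced, in the tree, to the single inequality `Z* ≥ 0`
of the gen-18/19 memos (there `u₁ − u₀ = v̄g''`, and `ΔΔ' ≥ 0` for up-sets since `S₀ ⊆ S₁`).
-/

namespace Summit.CriticalPhenomena.PercolationContinuityZ3.Theorems.SahiE3TwoLayerBernstein

open Finset SahiE3LroLayers SahiE3LroOrStep
open scoped BigOperators

variable {M : Type*} [Fintype M] [DecidableEq M]

/-- Layers of the two-layer slot `U = {true} × U₁ ∪ {false} × U₀` and of intersections with it. [this work] -/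
theorem layers_twoSlot (U₁ U₀ : Finset M) (U : Finset (Bool × M))
    (hU : ∀ x, x ∈ U ↔ ((x.1 = true ∧ x.2 ∈ U₁) ∨ (x.1 = false ∧ x.2 ∈ U₀))) (X : Finset (Bool × M)) :
    univ.filter (fun t => (true, t) ∈ X ∩ U) = univ.filter (fun t => (true, t) ∈ X) ∩ U₁ ∧
    univ.filter (fun t => (false, t) ∈ X ∩ U) = univ.filter (fun t => (false, t) ∈ X) ∩ U₀ ∧
    univ.filter (fun t => (true, t) ∈ U) = U₁ ∧
    univ.filter (fun t => (false, t) ∈ U) = U₀ := by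
  refine ⟨?_, ?_, ?_, ?_⟩ <;> ext t <;> simp [hU]

/-- **The two-layer Bernstein identity** for a root-quadratic composite certificate (see the module docstring): the slack of the pair
inequality of `U = {true}×U₁ ∪ {false}×U₀` at `(S,S')` equals `p²·slack₁(S₁,S₁') + q²·slack₀(S₀,S₀') + pq·[Z + q(u₁−u₀)ΔΔ']`.
[this work] -/
theorem slack_two_layer (μ : M → ℝ) (hμ1 : ∑ m, μ m = 1) (U₁ U₀ : Finset M) {u₁ u₀ : ℝ}
    (hu₁ : ∑ m ∈ U₁, μ m = u₁) (hu₀ : ∑ m ∈ U₀, μ m = u₀)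
    (Rn R0 Φ RA : M → ℝ) (p : ℝ) (ν : Bool × M → ℝ) (hνt : ∀ m, ν (true, m) = p * μ m)
    (hνf : ∀ m, ν (false, m) = (1 - p) * μ m) (R : Bool × M → ℝ)
    (hRt : ∀ m, R (true, m) = p ^ 2 * Rn m + p * (1 - p) * R0 m)
    (hRf : ∀ m, R (false, m) = p * (1 - p) * Φ m + (1 - p) ^ 2 * RA m)
    (U : Finset (Bool × M)) (hU : ∀ x, x ∈ U ↔ ((x.1 = true ∧ x.2 ∈ U₁) ∨ (x.1 = false ∧ x.2 ∈ U₀)))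
    (S S' : Finset (Bool × M)) (S₁ S₀ S₁' S₀' : Finset M)
    (hS₁ : S₁ = univ.filter (fun m => (true, m) ∈ S)) (hS₀ : S₀ = univ.filter (fun m => (false, m) ∈ S))
    (hS₁' : S₁' = univ.filter (fun m => (true, m) ∈ S')) (hS₀' : S₀' = univ.filter (fun m => (false, m) ∈ S')) :
    (∑ x ∈ S ∩ S', R x)
      - ((∑ r, ν r) * ((∑ x ∈ S, ν x) * (∑ x ∈ S' ∩ U, ν x) + (∑ x ∈ S', ν x) * (∑ x ∈ S ∩ U, ν x))
          - (∑ r ∈ U, ν r) * (∑ x ∈ S, ν x) * (∑ x ∈ S', ν x))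
    = p ^ 2 * ((∑ m ∈ S₁ ∩ S₁', Rn m)
          - ((∑ m ∈ S₁, μ m) * (∑ m ∈ S₁' ∩ U₁, μ m) + (∑ m ∈ S₁', μ m) * (∑ m ∈ S₁ ∩ U₁, μ m)
              - u₁ * (∑ m ∈ S₁, μ m) * (∑ m ∈ S₁', μ m)))
      + (1 - p) ^ 2 * ((∑ m ∈ S₀ ∩ S₀', RA m)
          - ((∑ m ∈ S₀, μ m) * (∑ m ∈ S₀' ∩ U₀, μ m) + (∑ m ∈ S₀', μ m) * (∑ m ∈ S₀ ∩ U₀, μ m)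
              - u₀ * (∑ m ∈ S₀, μ m) * (∑ m ∈ S₀', μ m)))
      + p * (1 - p) * (((∑ m ∈ S₁ ∩ S₁', R0 m) + (∑ m ∈ S₀ ∩ S₀', Φ m)
            + u₀ * ((∑ m ∈ S₁, μ m) * (∑ m ∈ S₀', μ m) + (∑ m ∈ S₀, μ m) * (∑ m ∈ S₁', μ m))
            + (u₁ - u₀) * ((∑ m ∈ S₀, μ m) * (∑ m ∈ S₀', μ m)
                - ((∑ m ∈ S₁, μ m) - ∑ m ∈ S₀, μ m) * ((∑ m ∈ S₁', μ m) - ∑ m ∈ S₀', μ m))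
            - (∑ m ∈ S₁, μ m) * (∑ m ∈ S₀' ∩ U₀, μ m) - (∑ m ∈ S₁', μ m) * (∑ m ∈ S₀ ∩ U₀, μ m)
            - (∑ m ∈ S₀, μ m) * (∑ m ∈ S₁' ∩ U₁, μ m) - (∑ m ∈ S₀', μ m) * (∑ m ∈ S₁ ∩ U₁, μ m))
          + (1 - p) * (u₁ - u₀)
              * (((∑ m ∈ S₁, μ m) - ∑ m ∈ S₀, μ m) * ((∑ m ∈ S₁', μ m) - ∑ m ∈ S₀', μ m))) := by
  -- layer decompositions of all the sums over `Bool × M`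
  have lay : ∀ X : Finset (Bool × M), ∑ x ∈ X, ν x =
      p * ∑ t ∈ univ.filter (fun t => (true, t) ∈ X), μ t
        + (1 - p) * ∑ t ∈ univ.filter (fun t => (false, t) ∈ X), μ t := by
    intro X
    rw [sum_layers, Finset.mul_sum, Finset.mul_sum]
    exact congrArg₂ (· + ·) (Finset.sum_congr rfl fun t _ => hνt t) (Finset.sum_congr rfl fun t _ => hνf t)
  have layR : ∑ x ∈ S ∩ S', R x =
      (∑ t ∈ univ.filter (fun t => (true, t) ∈ S ∩ S'), (p ^ 2 * Rn t + p * (1 - p) * R0 t))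
        + ∑ t ∈ univ.filter (fun t => (false, t) ∈ S ∩ S'), (p * (1 - p) * Φ t + (1 - p) ^ 2 * RA t) := by
    rw [sum_layers]
    exact congrArg₂ (· + ·) (Finset.sum_congr rfl fun t _ => hRt t) (Finset.sum_congr rfl fun t _ => hRf t)
  have hW₁ : univ.filter (fun t => (true, t) ∈ S ∩ S') = S₁ ∩ S₁' := by rw [layers_inter, hS₁, hS₁']
  have hW₀ : univ.filter (fun t => (false, t) ∈ S ∩ S') = S₀ ∩ S₀' := by rw [layers_inter, hS₀, hS₀']
  obtain ⟨LSU1, LSU0, LU1, LU0⟩ := layers_twoSlot U₁ U₀ U hU S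
  obtain ⟨LSU1', LSU0', -, -⟩ := layers_twoSlot U₁ U₀ U hU S'
  have eZ : ∑ x, ν x = 1 := by
    rw [sum_layers_univ, show ∑ t, ν (true, t) = p * ∑ t, μ t by
        rw [Finset.mul_sum]; exact Finset.sum_congr rfl fun t _ => hνt t,
      show ∑ t, ν (false, t) = (1 - p) * ∑ t, μ t by
        rw [Finset.mul_sum]; exact Finset.sum_congr rfl fun t _ => hνf t, hμ1]
    ring
  have eU : ∑ x ∈ U, ν x = p * u₁ + (1 - p) * u₀ := by rw [lay U, LU1, LU0, hu₁, hu₀]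
  have eS : ∑ x ∈ S, ν x = p * (∑ m ∈ S₁, μ m) + (1 - p) * ∑ m ∈ S₀, μ m := by rw [lay S, ← hS₁, ← hS₀]
  have eS' : ∑ x ∈ S', ν x = p * (∑ m ∈ S₁', μ m) + (1 - p) * ∑ m ∈ S₀', μ m := by rw [lay S', ← hS₁', ← hS₀']
  have eSU : ∑ x ∈ S ∩ U, ν x = p * (∑ m ∈ S₁ ∩ U₁, μ m) + (1 - p) * ∑ m ∈ S₀ ∩ U₀, μ m := by
    rw [lay (S ∩ U), LSU1, LSU0, ← hS₁, ← hS₀]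
  have eS'U : ∑ x ∈ S' ∩ U, ν x = p * (∑ m ∈ S₁' ∩ U₁, μ m) + (1 - p) * ∑ m ∈ S₀' ∩ U₀, μ m := by
    rw [lay (S' ∩ U), LSU1', LSU0', ← hS₁', ← hS₀']
  have eR : ∑ x ∈ S ∩ S', R x = p ^ 2 * (∑ m ∈ S₁ ∩ S₁', Rn m) + p * (1 - p) * (∑ m ∈ S₁ ∩ S₁', R0 m)
      + (p * (1 - p) * (∑ m ∈ S₀ ∩ S₀', Φ m) + (1 - p) ^ 2 * ∑ m ∈ S₀ ∩ S₀', RA m) := by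
    rw [layR, hW₁, hW₀, Finset.sum_add_distrib, Finset.sum_add_distrib, ← Finset.mul_sum, ← Finset.mul_sum,
      ← Finset.mul_sum, ← Finset.mul_sum]
  rw [eR, eZ, eU, eS, eS', eSU, eS'U]
  ring

/-- **Two-layer Bernstein reduction of the pair inequality.**  If `0 ≤ p ≤ 1`, the top-layer data `Rn` satisfy (L) for `U₁` at
`(S₁,S₁')`, the bottom-layer data `RA` satisfy (L) for `U₀` at `(S₀,S₀')`, and the mixed coefficient `Z + (1−p)(u₁−u₀)ΔΔ'` is nonnegative,
then the root-quadratic composite `R` satisfies (L) for the two-layer slot `U` at `(S,S')`. [this work] -/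
theorem pair_two_layer (μ : M → ℝ) (hμ1 : ∑ m, μ m = 1) (U₁ U₀ : Finset M) {u₁ u₀ : ℝ}
    (hu₁ : ∑ m ∈ U₁, μ m = u₁) (hu₀ : ∑ m ∈ U₀, μ m = u₀)
    (Rn R0 Φ RA : M → ℝ) {p : ℝ} (hp0 : 0 ≤ p) (hp1 : p ≤ 1) (ν : Bool × M → ℝ) (hνt : ∀ m, ν (true, m) = p * μ m)
    (hνf : ∀ m, ν (false, m) = (1 - p) * μ m) (R : Bool × M → ℝ)
    (hRt : ∀ m, R (true, m) = p ^ 2 * Rn m + p * (1 - p) * R0 m)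
    (hRf : ∀ m, R (false, m) = p * (1 - p) * Φ m + (1 - p) ^ 2 * RA m)
    (U : Finset (Bool × M)) (hU : ∀ x, x ∈ U ↔ ((x.1 = true ∧ x.2 ∈ U₁) ∨ (x.1 = false ∧ x.2 ∈ U₀)))
    (S S' : Finset (Bool × M)) (S₁ S₀ S₁' S₀' : Finset M)
    (hS₁ : S₁ = univ.filter (fun m => (true, m) ∈ S)) (hS₀ : S₀ = univ.filter (fun m => (false, m) ∈ S))
    (hS₁' : S₁' = univ.filter (fun m => (true, m) ∈ S')) (hS₀' : S₀' = univ.filter (fun m => (false, m) ∈ S'))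
    (htop : (∑ m ∈ S₁, μ m) * (∑ m ∈ S₁' ∩ U₁, μ m) + (∑ m ∈ S₁', μ m) * (∑ m ∈ S₁ ∩ U₁, μ m)
        - u₁ * (∑ m ∈ S₁, μ m) * (∑ m ∈ S₁', μ m) ≤ ∑ m ∈ S₁ ∩ S₁', Rn m)
    (hbot : (∑ m ∈ S₀, μ m) * (∑ m ∈ S₀' ∩ U₀, μ m) + (∑ m ∈ S₀', μ m) * (∑ m ∈ S₀ ∩ U₀, μ m)
        - u₀ * (∑ m ∈ S₀, μ m) * (∑ m ∈ S₀', μ m) ≤ ∑ m ∈ S₀ ∩ S₀', RA m)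
    (hmix : 0 ≤ ((∑ m ∈ S₁ ∩ S₁', R0 m) + (∑ m ∈ S₀ ∩ S₀', Φ m)
            + u₀ * ((∑ m ∈ S₁, μ m) * (∑ m ∈ S₀', μ m) + (∑ m ∈ S₀, μ m) * (∑ m ∈ S₁', μ m))
            + (u₁ - u₀) * ((∑ m ∈ S₀, μ m) * (∑ m ∈ S₀', μ m)
                - ((∑ m ∈ S₁, μ m) - ∑ m ∈ S₀, μ m) * ((∑ m ∈ S₁', μ m) - ∑ m ∈ S₀', μ m))
            - (∑ m ∈ S₁, μ m) * (∑ m ∈ S₀' ∩ U₀, μ m) - (∑ m ∈ S₁', μ m) * (∑ m ∈ S₀ ∩ U₀, μ m)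
            - (∑ m ∈ S₀, μ m) * (∑ m ∈ S₁' ∩ U₁, μ m) - (∑ m ∈ S₀', μ m) * (∑ m ∈ S₁ ∩ U₁, μ m))
          + (1 - p) * (u₁ - u₀)
              * (((∑ m ∈ S₁, μ m) - ∑ m ∈ S₀, μ m) * ((∑ m ∈ S₁', μ m) - ∑ m ∈ S₀', μ m))) :
    (∑ r, ν r) * ((∑ x ∈ S, ν x) * (∑ x ∈ S' ∩ U, ν x) + (∑ x ∈ S', ν x) * (∑ x ∈ S ∩ U, ν x))
        - (∑ r ∈ U, ν r) * (∑ x ∈ S, ν x) * (∑ x ∈ S', ν x) ≤ ∑ x ∈ S ∩ S', R x := by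
  have key := slack_two_layer μ hμ1 U₁ U₀ hu₁ hu₀ Rn R0 Φ RA p ν hνt hνf R hRt hRf U hU S S' S₁ S₀ S₁' S₀'
    hS₁ hS₀ hS₁' hS₀'
  have hq : 0 ≤ 1 - p := by linarith
  have h1 : 0 ≤ p ^ 2 * ((∑ m ∈ S₁ ∩ S₁', Rn m)
          - ((∑ m ∈ S₁, μ m) * (∑ m ∈ S₁' ∩ U₁, μ m) + (∑ m ∈ S₁', μ m) * (∑ m ∈ S₁ ∩ U₁, μ m)
              - u₁ * (∑ m ∈ S₁, μ m) * (∑ m ∈ S₁', μ m))) :=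
    mul_nonneg (pow_nonneg hp0 2) (by linarith)
  have h2 : 0 ≤ (1 - p) ^ 2 * ((∑ m ∈ S₀ ∩ S₀', RA m)
          - ((∑ m ∈ S₀, μ m) * (∑ m ∈ S₀' ∩ U₀, μ m) + (∑ m ∈ S₀', μ m) * (∑ m ∈ S₀ ∩ U₀, μ m)
              - u₀ * (∑ m ∈ S₀, μ m) * (∑ m ∈ S₀', μ m))) :=
    mul_nonneg (pow_nonneg hq 2) (by linarith)
  have h3 := mul_nonneg (mul_nonneg hp0 hq) hmix
  linarith [key, h1, h2, h3]

end Summit.CriticalPhenomena.PercolationContinuityZ3.Theorems.SahiE3TwoLayerBernstein
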